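import Literature.AlgebraicGeometry.HodgeTheory.FermatShiodaCondition
import HarnessLib

/-!
# Transfer of Hodge multisets from level `2n` to level `n` (`2 ∣ n`), from level `3n` to level `n` (`3 ∣ n`), and from level `ℓn` to level `n` (`ℓ` prime, `ℓ ∣ n`)

Topic `Literature/AlgebraicGeometry/HodgeTheory`. THEOREMS only (no definition, no named fact). For Shioda's Hodge multisets
(`FermatCharacter.IsHodgeMultiset`: non-zero residues mod `m` with sum `0` and `2 Σ ⟨t a⟩ = m · #s` for every unit `t`,
[Shioda1979PJA, §1 (2), (3)]) the following LEVEL-LOWERING maps preserve the Hodge property: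

* **`isHodgeMultiset_transfer_two`** (`m = 2n`, `2 ∣ n`): `T₂(s) = (odd members mod n) + 2·((even members)/2 mod n)` — reduce the
  members with odd representative modulo `n`, halve the representatives of the even members and count them twice;
* **`isHodgeMultiset_transfer_three`** (`m = 3n`, `3 ∣ n`): `T₃(s) = (members ≢ 0 (3) mod n) + 3·((members ≡ 0 (3))/3 mod n)`.
* **`isHodgeMultiset_transfer_prime`** (`m = ℓn`, `ℓ` prime, `ℓ ∣ n`): `T_ℓ(s) = (members ≢ 0 (ℓ) mod n) + ℓ·((members ≡ 0 (ℓ))/ℓ mod n)`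
  — the general form (added by LIT g29; the two special cases are kept verbatim for their users).

These are the general forms of the transfers `24p → 12p`, `20p → 10p` used (and proved ad hoc) in
`Shioda1982/HodgeQuadruplesTwentyFourPrime.lean` (`isHodgeMultiset_transfer_twentyFourPrime`) and
`Shioda1982/HodgeQuadruplesTwentyPrime.lean` (`isHodgeMultiset_transfer_twentyPrime`), stated here once for every level and without
the Chinese-remainder apparatus, for the next families of the series (`36p → 18p` and `36p → 12p`, cell `pub-hfermat`,
`pub-hfermat-lit/SCOPING-36p.md`; checked outside Lean on all Hodge `4`-multisets of the levels `140, 220` (`T₂`), `180, 252, 396`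
(`T₂`, `T₃`), `56, 88` (`T₂`), `135, 189` (`T₃`): `code/lit/picard/transfer36.py`, `0` failures; the divisibility hypothesis is
necessary: `T₂` fails at `10p → 5p`, `T₃` at `12p → 4p`).
PROOF (elementary shadow of the distribution relation of the first Bernoulli function, cf. [Aoki1983, Prop. 2.2]): for a unit `u` of
`ℤ/2n` also `u(1 + n)` is a unit (`n² ≡ 0`, `2n ≡ 0 (mod 2n)` when `2 ∣ n`), and `u(1 + n)w = uw + n` for odd `w`, `= uw` for even
`w`; adding the two norm equations and using `⟨y⟩ + ⟨y + n⟩ = 2(⟨y⟩ mod n) + n`, `⟨2y⟩ = 2(⟨y⟩ mod n)` gives the norm equation of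
`T₂(s)` at `ū`, and every unit of `ℤ/n` is such a `ū`. For `3n`: the units `u`, `u(1 + n)`, `u(1 + 2n)`; for `3 ∤ w` the three
products are `uw, uw + n, uw + 2n` in some order and `⟨y⟩ + ⟨y + n⟩ + ⟨y + 2n⟩ = 3(⟨y⟩ mod n) + 3n`; for `3 ∣ w` all three equal
`uw = 3·u(w/3)` and `⟨3y⟩ = 3(⟨y⟩ mod n)`.
For `ℓn`, `ℓ` prime: the `ℓ` units `u(1 + jn)`, `j mod ℓ` (`n² ≡ 0`); for `ℓ ∤ w` the products `u(1 + jn)w = uw + j⟨uw⟩n` run through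
`uw + kn`, `k mod ℓ` (a dilation of the field `ℤ/ℓ`), and `Σ_k ⟨y + kn⟩ = ℓ(⟨y⟩ mod n) + n·ℓ(ℓ−1)/2` (a translation of `ℤ/ℓ`); for `ℓ ∣ w` all
products equal `uw = ℓ·u(w/ℓ)`; add the `ℓ` norm equations and divide by `ℓ` (`isHodgeMultiset_transfer_prime`).

HONEST FRAMING (cell `pub-hfermat`): explicit algebraic cycles for specific Hodge classes on Fermat/Delsarte varieties; residual open
instances listed; no claim on general Hodge. (An elementary identity about Shioda's Hodge condition; no cycle is constructed here.)

## References
* [Shioda1979PJA] T. Shioda, *The Hodge conjecture and the Tate conjecture for Fermat varieties*, Proc. Japan Acad. 55A (1979)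
  111–114, §1 eqs. (2), (3).
* [Aoki1983] N. Aoki, *On some arithmetic problems related to the Hodge cycles on the Fermat varieties*, Math. Ann. 266 (1983) 23–54,
  Prop. 2.2 (level change).
* [Shioda1982PicardFermat] T. Shioda, J. Fac. Sci. Univ. Tokyo IA 28 (1982) 725–734, Prop. 4 (Q′) p. 729 (`m = 2m′`, `m′` even).
-/

namespace Literature.AlgebraicGeometry.HodgeTheory

namespace FermatCharacter

open Multiset

variable {n : ℕ}

/-! ### Arithmetic of representatives at the levels `2n` and `n` -/

/-- The norm sum of a mapped multiset as a sum of representatives. [folklore] -/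
private theorem mNormSum_map' {X : Type*} (t : Multiset X) {k : ℕ} (g : X → ZMod k) :
    mNormSum (t.map g) = (t.map fun w ↦ (g w).val).sum := by
  simp only [mNormSum, Multiset.map_map, Function.comp_def]

/-- `⟨n⟩ = n` at level `2n`. [folklore] -/
private theorem val_K [NeZero n] : ((n : ℕ) : ZMod (2 * n)).val = n := by
  rw [ZMod.val_natCast, Nat.mod_eq_of_lt (by have := NeZero.pos n; omega)]

/-- `2·n = 0` at level `2n`. [folklore] -/
private theorem two_mul_K : (2 : ZMod (2 * n)) * (n : ZMod (2 * n)) = 0 := by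
  have : (2 : ZMod (2 * n)) * (n : ZMod (2 * n)) = ((2 * n : ℕ) : ZMod (2 * n)) := by push_cast; ring
  rw [this, ZMod.natCast_self]

/-- `n·n = 0` at level `2n` when `2 ∣ n`. [folklore] -/
private theorem K_mul_K (hn : 2 ∣ n) : (n : ZMod (2 * n)) * (n : ZMod (2 * n)) = 0 := by
  obtain ⟨k, rfl⟩ := hn
  have : ((2 * k : ℕ) : ZMod (2 * (2 * k))) * ((2 * k : ℕ) : ZMod (2 * (2 * k))) =
      (k : ZMod (2 * (2 * k))) * ((2 * (2 * k) : ℕ) : ZMod (2 * (2 * k))) := by push_cast; ring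
  rw [this, ZMod.natCast_self, mul_zero]

/-- `n · x = n` for odd `x`, `= 0` for even `x` (level `2n`). [folklore] -/
private theorem K_mul [NeZero n] (x : ZMod (2 * n)) :
    (n : ZMod (2 * n)) * x = if x.val % 2 = 1 then (n : ZMod (2 * n)) else 0 := by
  haveI : NeZero (2 * n) := ⟨by have := NeZero.ne n; omega⟩
  have e : x = ((x.val : ℕ) : ZMod (2 * n)) := (ZMod.natCast_zmod_val x).symm
  have hd := Nat.div_add_mod x.val 2
  have h2 := two_mul_K (n := n)
  split_ifs with h
  · rw [h] at hd
    conv_lhs => rw [e, ← hd]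
    push_cast
    linear_combination (↑(x.val / 2) : ZMod (2 * n)) * h2
  · have h0 : x.val % 2 = 0 := by omega
    rw [h0, add_zero] at hd
    conv_lhs => rw [e, ← hd]
    push_cast
    linear_combination (↑(x.val / 2) : ZMod (2 * n)) * h2

/-- A unit of `ℤ/2n` is odd. [folklore] -/
private theorem odd_of_isUnit_two {u : ZMod (2 * n)} (hu : IsUnit u) [NeZero n] : u.val % 2 = 1 := by
  haveI : NeZero (2 * n) := ⟨by have := NeZero.ne n; omega⟩
  obtain ⟨u, rfl⟩ := hu
  have hc := ZMod.val_coe_unit_coprime u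
  by_contra h
  have h2 : 2 ∣ (u : ZMod (2 * n)).val := Nat.dvd_of_mod_eq_zero (by omega)
  have : 2 ∣ Nat.gcd (u : ZMod (2 * n)).val (2 * n) := Nat.dvd_gcd h2 ⟨n, rfl⟩
  rw [hc] at this
  omega

/-- `1 + n` is a unit of `ℤ/2n` (an involution) when `2 ∣ n`. [folklore] -/
private theorem isUnit_one_add_K (hn : 2 ∣ n) : IsUnit (1 + (n : ZMod (2 * n))) := by
  have h1 : (1 + (n : ZMod (2 * n))) * (1 + (n : ZMod (2 * n))) = 1 := by
    linear_combination K_mul_K hn + two_mul_K (n := n)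
  exact ⟨⟨_, _, h1, h1⟩, rfl⟩

/-- **`⟨y⟩ + ⟨y + n⟩ = 2(⟨y⟩ mod n) + n`** at level `2n`. [folklore] -/
private theorem val_add_val_add_K [NeZero n] (y : ZMod (2 * n)) :
    y.val + (y + (n : ZMod (2 * n))).val = 2 * (y.val % n) + n := by
  haveI : NeZero (2 * n) := ⟨by have := NeZero.ne n; omega⟩
  have hy := ZMod.val_lt y
  have hK := val_K (n := n)
  rw [ZMod.val_add, hK]
  by_cases h : y.val < n
  · rw [Nat.mod_eq_of_lt (by omega), Nat.mod_eq_of_lt h]; omega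
  · rw [Nat.mod_eq_sub_mod (by omega), Nat.mod_eq_of_lt (by omega),
      Nat.mod_eq_sub_mod (by omega), Nat.mod_eq_of_lt (by omega)]
    omega

/-- **`⟨2y⟩ = 2(⟨y⟩ mod n)`** at level `2n`. [folklore] -/
private theorem val_two_mul_eq [NeZero n] (y : ZMod (2 * n)) : ((2 : ZMod (2 * n)) * y).val = 2 * (y.val % n) := by
  haveI : NeZero (2 * n) := ⟨by have := NeZero.ne n; omega⟩
  have h2 : ((2 : ZMod (2 * n))).val = 2 % (2 * n) := by
    rw [show (2 : ZMod (2 * n)) = ((2 : ℕ) : ZMod (2 * n)) by norm_cast, ZMod.val_natCast]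
  have hy := ZMod.val_lt y
  rw [ZMod.val_mul, h2, Nat.mod_mul_mod]
  by_cases h : y.val < n
  · rw [Nat.mod_eq_of_lt (by omega), Nat.mod_eq_of_lt h]
  · rw [Nat.mod_eq_sub_mod (by omega), Nat.mod_eq_of_lt (by omega),
      Nat.mod_eq_sub_mod (by omega), Nat.mod_eq_of_lt (by omega)]
    omega

/-- The reduction `ℤ/2n → ℤ/n` on representatives. [folklore] -/
private theorem val_castHom_two [NeZero n] (hnm : n ∣ 2 * n) (y : ZMod (2 * n)) :
    (ZMod.castHom hnm (ZMod n) y).val = y.val % n := by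
  haveI : NeZero (2 * n) := ⟨by have := NeZero.ne n; omega⟩
  rw [ZMod.castHom_apply, ZMod.cast_eq_val, ZMod.val_natCast]

/-- `2 · (⟨w⟩/2) = w` for even `w` (level `2n`). [folklore] -/
private theorem two_mul_half [NeZero n] {w : ZMod (2 * n)} (hw : w.val % 2 = 0) :
    (2 : ZMod (2 * n)) * ((w.val / 2 : ℕ) : ZMod (2 * n)) = w := by
  haveI : NeZero (2 * n) := ⟨by have := NeZero.ne n; omega⟩
  have h := Nat.div_add_mod w.val 2
  rw [hw, add_zero] at h
  calc (2 : ZMod (2 * n)) * ((w.val / 2 : ℕ) : ZMod (2 * n)) = (((2 * (w.val / 2) : ℕ)) : ZMod (2 * n)) := by push_cast; ring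
    _ = w := by rw [h, ZMod.natCast_zmod_val]

/-- **Transfer `2n → n`.** For `2 ∣ n`, split a multiset over `ℤ/2n` into its members with odd representative (`s₁`) and with
even representative (`s₀`); if `s₁ + s₀` is a Hodge multiset of level `2n`, then
`T₂ = (s₁ reduced mod n) + 2·((representatives of s₀)/2, read mod n)` is a Hodge multiset of level `n`. (General form of
`Shioda1982.isHodgeMultiset_transfer_twentyPrime` / `…_twentyFourPrime`.)
[cite: Aoki1983, Prop. 2.2] [cite: Shioda1979PJA, §1 eq. (2)] [cite: Shioda1982PicardFermat, Prop. 4 (Q′) p. 729] -/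
theorem isHodgeMultiset_transfer_two [NeZero n] (hn : 2 ∣ n) (hnm : n ∣ 2 * n) {s₁ s₀ : Multiset (ZMod (2 * n))}
    (h₁ : ∀ w ∈ s₁, w.val % 2 = 1) (h₀ : ∀ w ∈ s₀, w.val % 2 = 0) (hs : IsHodgeMultiset (s₁ + s₀)) :
    IsHodgeMultiset (s₁.map (ZMod.castHom hnm (ZMod n)) +
      2 • s₀.map fun w ↦ ZMod.castHom hnm (ZMod n) ((w.val / 2 : ℕ) : ZMod (2 * n))) := by
  classical
  haveI : NeZero (2 * n) := ⟨by have := NeZero.ne n; omega⟩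
  have hn0 := NeZero.pos n
  set R := ZMod.castHom hnm (ZMod n) with hR
  set K : ZMod (2 * n) := (n : ZMod (2 * n)) with hKdef
  obtain ⟨⟨hne, hsum⟩, hnorm⟩ := hs
  rw [two_nsmul]
  refine ⟨⟨?_, ?_⟩, fun v ↦ ?_⟩
  · -- members are non-zero
    have hA : ∀ a ∈ s₀.map (fun w ↦ R ((w.val / 2 : ℕ) : ZMod (2 * n))), a ≠ 0 := by
      intro a ha
      obtain ⟨w, hw, rfl⟩ := Multiset.mem_map.mp ha
      intro h
      have hv := congrArg ZMod.val h
      rw [val_castHom_two, ZMod.val_zero, ZMod.val_natCast, Nat.mod_mod_of_dvd _ hnm] at hv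
      have hlt := ZMod.val_lt w
      have h0' : w.val / 2 = 0 := Nat.eq_zero_of_dvd_of_lt (Nat.dvd_of_mod_eq_zero hv) (by omega)
      have hw0 : w.val = 0 := by have := h₀ w hw; omega
      exact hne w (Multiset.mem_add.mpr (Or.inr hw)) ((ZMod.val_eq_zero w).mp hw0)
    intro a ha
    rcases Multiset.mem_add.mp ha with ha | ha
    · obtain ⟨w, hw, rfl⟩ := Multiset.mem_map.mp ha
      intro h
      have hv := congrArg ZMod.val h
      rw [val_castHom_two, ZMod.val_zero] at hv
      obtain ⟨k, hk⟩ := Nat.dvd_of_mod_eq_zero hv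
      obtain ⟨j, hj⟩ := hn
      have h2 : 2 ∣ w.val := ⟨j * k, by rw [hk, hj, mul_assoc]⟩
      have := h₁ w hw
      omega
    · rcases Multiset.mem_add.mp ha with ha | ha
      · exact hA a ha
      · exact hA a ha
  · -- the sum is zero
    have e1 : (s₁.map R).sum = R s₁.sum := (map_multiset_sum R s₁).symm
    have e2 : (s₀.map fun w ↦ R ((w.val / 2 : ℕ) : ZMod (2 * n))).sum +
        (s₀.map fun w ↦ R ((w.val / 2 : ℕ) : ZMod (2 * n))).sum = R s₀.sum := by
      rw [← Multiset.sum_map_add, map_multiset_sum]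
      congr 1
      refine Multiset.map_congr rfl fun w hw ↦ ?_
      rw [← RingHom.map_add, ← two_mul, two_mul_half (h₀ w hw)]
    rw [Multiset.sum_add, Multiset.sum_add, e1, e2, ← RingHom.map_add, ← Multiset.sum_add, hsum, RingHom.map_zero]
  · -- the norm equations
    obtain ⟨u, hu⟩ := ZMod.unitsMap_surjective hnm v
    have hvu : (v : ZMod n) = R u := by rw [← hu]; simp [ZMod.unitsMap_def, hR]
    obtain ⟨w1, hw1⟩ := isUnit_one_add_K hn
    have odd_u : (u : ZMod (2 * n)).val % 2 = 1 := odd_of_isUnit_two u.isUnit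
    have hKu : K * (u : ZMod (2 * n)) = K := by rw [hKdef, K_mul, if_pos odd_u]
    have e1 := hnorm u
    have e2 := hnorm (u * w1)
    rw [Multiset.map_add, mNormSum_add, mNormSum_map', mNormSum_map', Multiset.card_add] at e1 e2
    have eso : (s₁.map fun w ↦ (((u * w1 : (ZMod (2 * n))ˣ) : ZMod (2 * n)) * w).val) =
        s₁.map fun w ↦ ((u : ZMod (2 * n)) * w + K).val := by
      refine Multiset.map_congr rfl fun w hw ↦ ?_
      have hKw : K * w = K := by rw [hKdef, K_mul, if_pos (h₁ w hw)]
      rw [Units.val_mul, hw1]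
      congr 1
      linear_combination (u : ZMod (2 * n)) * hKw + hKu
    have ese : (s₀.map fun w ↦ (((u * w1 : (ZMod (2 * n))ˣ) : ZMod (2 * n)) * w).val) =
        s₀.map fun w ↦ ((u : ZMod (2 * n)) * w).val := by
      refine Multiset.map_congr rfl fun w hw ↦ ?_
      have hKw : K * w = 0 := by rw [hKdef, K_mul, if_neg (by rw [h₀ w hw]; omega)]
      rw [Units.val_mul, hw1]
      congr 1
      linear_combination (u : ZMod (2 * n)) * hKw
    rw [eso, ese] at e2
    have hO : (s₁.map fun w ↦ ((u : ZMod (2 * n)) * w).val).sum + (s₁.map fun w ↦ ((u : ZMod (2 * n)) * w + K).val).sum =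
        2 * (s₁.map fun w ↦ (R ((u : ZMod (2 * n)) * w)).val).sum + n * Multiset.card s₁ := by
      rw [← Multiset.sum_map_add]
      have : (s₁.map fun w ↦ ((u : ZMod (2 * n)) * w).val + ((u : ZMod (2 * n)) * w + K).val) =
          s₁.map fun w ↦ 2 * (R ((u : ZMod (2 * n)) * w)).val + n := by
        refine Multiset.map_congr rfl fun w _ ↦ ?_
        rw [val_castHom_two, hKdef, val_add_val_add_K]
      rw [this, Multiset.sum_map_add, Multiset.sum_map_mul_left, Multiset.map_const', Multiset.sum_replicate, smul_eq_mul,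
        mul_comm (Multiset.card s₁)]
    have hE : (s₀.map fun w ↦ ((u : ZMod (2 * n)) * w).val).sum =
        2 * (s₀.map fun w ↦ (R ((u : ZMod (2 * n)) * ((w.val / 2 : ℕ) : ZMod (2 * n)))).val).sum := by
      rw [← Multiset.sum_map_mul_left]
      congr 1
      refine Multiset.map_congr rfl fun w hw ↦ ?_
      rw [val_castHom_two, ← val_two_mul_eq, mul_left_comm, two_mul_half (h₀ w hw)]
    simp only [Multiset.map_add, mNormSum_add, Multiset.map_map, mNormSum_map', Multiset.card_add, Multiset.card_map,
      Function.comp_apply]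
    have tso : (s₁.map fun w ↦ ((v : ZMod n) * R w).val) = s₁.map fun w ↦ (R ((u : ZMod (2 * n)) * w)).val := by
      refine Multiset.map_congr rfl fun w _ ↦ ?_
      rw [hvu, ← map_mul]
    have tse : (s₀.map fun w ↦ ((v : ZMod n) * R ((w.val / 2 : ℕ) : ZMod (2 * n))).val) =
        s₀.map fun w ↦ (R ((u : ZMod (2 * n)) * ((w.val / 2 : ℕ) : ZMod (2 * n)))).val := by
      refine Multiset.map_congr rfl fun w _ ↦ ?_
      rw [hvu, ← map_mul]
    rw [tso, tse]
    generalize Multiset.card s₁ = c₁ at e1 e2 hO ⊢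
    generalize Multiset.card s₀ = c₀ at e1 e2 ⊢
    generalize (s₁.map fun w ↦ (R ((u : ZMod (2 * n)) * w)).val).sum = A at hO ⊢
    generalize (s₀.map fun w ↦ (R ((u : ZMod (2 * n)) * ((w.val / 2 : ℕ) : ZMod (2 * n)))).val).sum = B at hE ⊢
    generalize (s₁.map fun w ↦ ((u : ZMod (2 * n)) * w).val).sum = A₁ at e1 e2 hO
    generalize (s₁.map fun w ↦ ((u : ZMod (2 * n)) * w + K).val).sum = A₂ at e2 hO
    generalize (s₀.map fun w ↦ ((u : ZMod (2 * n)) * w).val).sum = B₁ at e1 e2 hE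
    have e3 : 2 * n * (c₁ + c₀) = 2 * (n * c₁) + 2 * (n * c₀) := by ring
    rw [e3] at e1 e2
    have : n * (c₁ + (c₀ + c₀)) = n * c₁ + 2 * (n * c₀) := by ring
    rw [this]
    nlinarith [e1, e2, hO, hE]

/-! ### Arithmetic of representatives at the levels `3n` and `n` -/

/-- `⟨n⟩ = n` at level `3n`. [folklore] -/
private theorem val_K₃ [NeZero n] : ((n : ℕ) : ZMod (3 * n)).val = n := by
  rw [ZMod.val_natCast, Nat.mod_eq_of_lt (by have := NeZero.pos n; omega)]

/-- `3·n = 0` at level `3n`. [folklore] -/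
private theorem three_mul_K : (3 : ZMod (3 * n)) * (n : ZMod (3 * n)) = 0 := by
  have : (3 : ZMod (3 * n)) * (n : ZMod (3 * n)) = ((3 * n : ℕ) : ZMod (3 * n)) := by push_cast; ring
  rw [this, ZMod.natCast_self]

/-- `n·n = 0` at level `3n` when `3 ∣ n`. [folklore] -/
private theorem K_mul_K₃ (hn : 3 ∣ n) : (n : ZMod (3 * n)) * (n : ZMod (3 * n)) = 0 := by
  obtain ⟨k, rfl⟩ := hn
  have : ((3 * k : ℕ) : ZMod (3 * (3 * k))) * ((3 * k : ℕ) : ZMod (3 * (3 * k))) =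
      (k : ZMod (3 * (3 * k))) * ((3 * (3 * k) : ℕ) : ZMod (3 * (3 * k))) := by push_cast; ring
  rw [this, ZMod.natCast_self, mul_zero]

/-- `n · x = (⟨x⟩ mod 3) · n` at level `3n`. [folklore] -/
private theorem K_mul₃ [NeZero n] (x : ZMod (3 * n)) :
    (n : ZMod (3 * n)) * x = ((x.val % 3 : ℕ) : ZMod (3 * n)) * (n : ZMod (3 * n)) := by
  haveI : NeZero (3 * n) := ⟨by have := NeZero.ne n; omega⟩
  have e : x = ((x.val : ℕ) : ZMod (3 * n)) := (ZMod.natCast_zmod_val x).symm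
  have hd := Nat.div_add_mod x.val 3
  have h3 := three_mul_K (n := n)
  conv_lhs => rw [e, ← hd]
  push_cast
  linear_combination (↑(x.val / 3) : ZMod (3 * n)) * h3

/-- A unit of `ℤ/3n` is not divisible by `3`. [folklore] -/
private theorem mod_three_ne_zero_of_isUnit {u : ZMod (3 * n)} (hu : IsUnit u) [NeZero n] : u.val % 3 ≠ 0 := by
  haveI : NeZero (3 * n) := ⟨by have := NeZero.ne n; omega⟩
  obtain ⟨u, rfl⟩ := hu
  have hc := ZMod.val_coe_unit_coprime u
  intro h
  have h3 : 3 ∣ (u : ZMod (3 * n)).val := Nat.dvd_of_mod_eq_zero h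
  have : 3 ∣ Nat.gcd (u : ZMod (3 * n)).val (3 * n) := Nat.dvd_gcd h3 ⟨n, rfl⟩
  rw [hc] at this
  omega

/-- `1 + n` is a unit of `ℤ/3n` (with inverse `1 + 2n`) when `3 ∣ n`. [folklore] -/
private theorem isUnit_one_add_K₃ (hn : 3 ∣ n) : IsUnit (1 + (n : ZMod (3 * n))) := by
  have h1 : (1 + (n : ZMod (3 * n))) * (1 + 2 * (n : ZMod (3 * n))) = 1 := by
    linear_combination (2 : ZMod (3 * n)) * K_mul_K₃ hn + three_mul_K (n := n)
  have h2 : (1 + 2 * (n : ZMod (3 * n))) * (1 + (n : ZMod (3 * n))) = 1 := by linear_combination h1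
  exact ⟨⟨_, _, h1, h2⟩, rfl⟩

/-- `1 + 2n` is a unit of `ℤ/3n` (with inverse `1 + n`) when `3 ∣ n`. [folklore] -/
private theorem isUnit_one_add_two_K₃ (hn : 3 ∣ n) : IsUnit (1 + 2 * (n : ZMod (3 * n))) := by
  have h1 : (1 + (n : ZMod (3 * n))) * (1 + 2 * (n : ZMod (3 * n))) = 1 := by
    linear_combination (2 : ZMod (3 * n)) * K_mul_K₃ hn + three_mul_K (n := n)
  have h2 : (1 + 2 * (n : ZMod (3 * n))) * (1 + (n : ZMod (3 * n))) = 1 := by linear_combination h1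
  exact ⟨⟨_, _, h2, h1⟩, rfl⟩

/-- **`⟨y⟩ + ⟨y + n⟩ + ⟨y + 2n⟩ = 3(⟨y⟩ mod n) + 3n`** at level `3n`. [folklore] -/
private theorem val_add_three [NeZero n] (y : ZMod (3 * n)) :
    y.val + (y + (n : ZMod (3 * n))).val + (y + 2 * (n : ZMod (3 * n))).val = 3 * (y.val % n) + 3 * n := by
  haveI : NeZero (3 * n) := ⟨by have := NeZero.ne n; omega⟩
  have hy := ZMod.val_lt y
  have hK := val_K₃ (n := n)
  have h2K : (2 * (n : ZMod (3 * n))).val = 2 * n := by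
    rw [show (2 : ZMod (3 * n)) * (n : ZMod (3 * n)) = ((2 * n : ℕ) : ZMod (3 * n)) by push_cast; ring, ZMod.val_natCast,
      Nat.mod_eq_of_lt (by have := NeZero.pos n; omega)]
  rw [ZMod.val_add, ZMod.val_add y, hK, h2K]
  have hdm := Nat.div_add_mod y.val n
  have hml := Nat.mod_lt y.val (NeZero.pos n)
  have hc : y.val / n < 3 := by
    apply Nat.div_lt_of_lt_mul; omega
  interval_cases hq : y.val / n
  · rw [Nat.mod_eq_of_lt (a := y.val + n) (by omega), Nat.mod_eq_of_lt (a := y.val + 2 * n) (by omega)]; omega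
  · rw [Nat.mod_eq_of_lt (a := y.val + n) (by omega), Nat.mod_eq_sub_mod (a := y.val + 2 * n) (by omega),
      Nat.mod_eq_of_lt (by omega)]; omega
  · rw [Nat.mod_eq_sub_mod (a := y.val + n) (by omega), Nat.mod_eq_of_lt (by omega),
      Nat.mod_eq_sub_mod (a := y.val + 2 * n) (by omega), Nat.mod_eq_of_lt (by omega)]; omega

/-- **`⟨3y⟩ = 3(⟨y⟩ mod n)`** at level `3n`. [folklore] -/
private theorem val_three_mul_eq [NeZero n] (y : ZMod (3 * n)) : ((3 : ZMod (3 * n)) * y).val = 3 * (y.val % n) := by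
  haveI : NeZero (3 * n) := ⟨by have := NeZero.ne n; omega⟩
  have h3 : ((3 : ZMod (3 * n))).val = 3 % (3 * n) := by
    rw [show (3 : ZMod (3 * n)) = ((3 : ℕ) : ZMod (3 * n)) by norm_cast, ZMod.val_natCast]
  have hy := ZMod.val_lt y
  rw [ZMod.val_mul, h3, Nat.mod_mul_mod]
  have hdm := Nat.div_add_mod y.val n
  have hml := Nat.mod_lt y.val (NeZero.pos n)
  have e : 3 * y.val = 3 * (y.val % n) + (3 * n) * (y.val / n) := by
    conv_lhs => rw [← hdm]
    ring
  rw [e, Nat.add_mul_mod_self_left, Nat.mod_eq_of_lt (by omega)]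

/-- The reduction `ℤ/3n → ℤ/n` on representatives. [folklore] -/
private theorem val_castHom_three [NeZero n] (hnm : n ∣ 3 * n) (y : ZMod (3 * n)) :
    (ZMod.castHom hnm (ZMod n) y).val = y.val % n := by
  haveI : NeZero (3 * n) := ⟨by have := NeZero.ne n; omega⟩
  rw [ZMod.castHom_apply, ZMod.cast_eq_val, ZMod.val_natCast]

/-- `3 · (⟨w⟩/3) = w` for `w` with representative `≡ 0 (mod 3)` (level `3n`). [folklore] -/
private theorem three_mul_third [NeZero n] {w : ZMod (3 * n)} (hw : w.val % 3 = 0) :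
    (3 : ZMod (3 * n)) * ((w.val / 3 : ℕ) : ZMod (3 * n)) = w := by
  haveI : NeZero (3 * n) := ⟨by have := NeZero.ne n; omega⟩
  have h := Nat.div_add_mod w.val 3
  rw [hw, add_zero] at h
  calc (3 : ZMod (3 * n)) * ((w.val / 3 : ℕ) : ZMod (3 * n)) = (((3 * (w.val / 3) : ℕ)) : ZMod (3 * n)) := by push_cast; ring
    _ = w := by rw [h, ZMod.natCast_zmod_val]

/-- The product of two residues not divisible by `3` is not divisible by `3` (level `3n`). [folklore] -/
private theorem mul_mod_three_ne_zero [NeZero n] {u w : ZMod (3 * n)} (hu : u.val % 3 ≠ 0) (hw : w.val % 3 ≠ 0) :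
    (u * w).val % 3 ≠ 0 := by
  haveI : NeZero (3 * n) := ⟨by have := NeZero.ne n; omega⟩
  rw [ZMod.val_mul, Nat.mod_mod_of_dvd _ ⟨n, rfl⟩, Nat.mul_mod]
  have hu' : u.val % 3 < 3 := Nat.mod_lt _ (by norm_num)
  have hw' : w.val % 3 < 3 := Nat.mod_lt _ (by norm_num)
  interval_cases u.val % 3 <;> interval_cases w.val % 3 <;> simp_all

/-- **Transfer `3n → n`.** For `3 ∣ n`, split a multiset over `ℤ/3n` into its members with representative `≢ 0 (mod 3)` (`s₁`)
and `≡ 0 (mod 3)` (`s₀`); if `s₁ + s₀` is a Hodge multiset of level `3n`, then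
`T₃ = (s₁ reduced mod n) + 3·((representatives of s₀)/3, read mod n)` is a Hodge multiset of level `n`.
[cite: Aoki1983, Prop. 2.2] [cite: Shioda1979PJA, §1 eq. (2)] -/
theorem isHodgeMultiset_transfer_three [NeZero n] (hn : 3 ∣ n) (hnm : n ∣ 3 * n) {s₁ s₀ : Multiset (ZMod (3 * n))}
    (h₁ : ∀ w ∈ s₁, w.val % 3 ≠ 0) (h₀ : ∀ w ∈ s₀, w.val % 3 = 0) (hs : IsHodgeMultiset (s₁ + s₀)) :
    IsHodgeMultiset (s₁.map (ZMod.castHom hnm (ZMod n)) +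
      3 • s₀.map fun w ↦ ZMod.castHom hnm (ZMod n) ((w.val / 3 : ℕ) : ZMod (3 * n))) := by
  classical
  haveI : NeZero (3 * n) := ⟨by have := NeZero.ne n; omega⟩
  have hn0 := NeZero.pos n
  set R := ZMod.castHom hnm (ZMod n) with hR
  set K : ZMod (3 * n) := (n : ZMod (3 * n)) with hKdef
  obtain ⟨⟨hne, hsum⟩, hnorm⟩ := hs
  rw [succ_nsmul, two_nsmul]
  refine ⟨⟨?_, ?_⟩, fun v ↦ ?_⟩
  · -- members are non-zero
    have hA : ∀ a ∈ s₀.map (fun w ↦ R ((w.val / 3 : ℕ) : ZMod (3 * n))), a ≠ 0 := by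
      intro a ha
      obtain ⟨w, hw, rfl⟩ := Multiset.mem_map.mp ha
      intro h
      have hv := congrArg ZMod.val h
      rw [val_castHom_three, ZMod.val_zero, ZMod.val_natCast, Nat.mod_mod_of_dvd _ hnm] at hv
      have hlt := ZMod.val_lt w
      have h0' : w.val / 3 = 0 := Nat.eq_zero_of_dvd_of_lt (Nat.dvd_of_mod_eq_zero hv) (by omega)
      have hw0 : w.val = 0 := by have := h₀ w hw; omega
      exact hne w (Multiset.mem_add.mpr (Or.inr hw)) ((ZMod.val_eq_zero w).mp hw0)
    intro a ha
    rcases Multiset.mem_add.mp ha with ha | ha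
    · obtain ⟨w, hw, rfl⟩ := Multiset.mem_map.mp ha
      intro h
      have hv := congrArg ZMod.val h
      rw [val_castHom_three, ZMod.val_zero] at hv
      obtain ⟨k, hk⟩ := Nat.dvd_of_mod_eq_zero hv
      obtain ⟨j, hj⟩ := hn
      exact h₁ w hw (Nat.mod_eq_zero_of_dvd ⟨j * k, by rw [hk, hj, mul_assoc]⟩)
    · rcases Multiset.mem_add.mp ha with ha | ha
      · rcases Multiset.mem_add.mp ha with ha | ha
        · exact hA a ha
        · exact hA a ha
      · exact hA a ha
  · -- the sum is zero
    have e1 : (s₁.map R).sum = R s₁.sum := (map_multiset_sum R s₁).symm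
    have e2 : (s₀.map fun w ↦ R ((w.val / 3 : ℕ) : ZMod (3 * n))).sum +
        (s₀.map fun w ↦ R ((w.val / 3 : ℕ) : ZMod (3 * n))).sum +
        (s₀.map fun w ↦ R ((w.val / 3 : ℕ) : ZMod (3 * n))).sum = R s₀.sum := by
      rw [← Multiset.sum_map_add, ← Multiset.sum_map_add, map_multiset_sum]
      congr 1
      refine Multiset.map_congr rfl fun w hw ↦ ?_
      rw [← RingHom.map_add, ← RingHom.map_add]
      congr 1
      have e := three_mul_third (h₀ w hw)
      calc _ = (3 : ZMod (3 * n)) * ((w.val / 3 : ℕ) : ZMod (3 * n)) := by ring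
        _ = w := e
    rw [Multiset.sum_add, Multiset.sum_add, Multiset.sum_add, e1, e2, ← RingHom.map_add, ← Multiset.sum_add, hsum,
      RingHom.map_zero]
  · -- the norm equations
    obtain ⟨u, hu⟩ := ZMod.unitsMap_surjective hnm v
    have hvu : (v : ZMod n) = R u := by rw [← hu]; simp [ZMod.unitsMap_def, hR]
    obtain ⟨w1, hw1⟩ := isUnit_one_add_K₃ hn
    obtain ⟨w2, hw2⟩ := isUnit_one_add_two_K₃ hn
    have hu3 : (u : ZMod (3 * n)).val % 3 ≠ 0 := mod_three_ne_zero_of_isUnit u.isUnit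
    have e1 := hnorm u
    have e2 := hnorm (u * w1)
    have e3 := hnorm (u * w2)
    rw [Multiset.map_add, mNormSum_add, mNormSum_map', mNormSum_map', Multiset.card_add] at e1 e2 e3
    -- the members `≢ 0 (3)`: the three products are `y, y + n, y + 2n` in some order
    have h12 : ∀ w ∈ s₁, (((u * w1 : (ZMod (3 * n))ˣ) : ZMod (3 * n)) * w).val +
        (((u * w2 : (ZMod (3 * n))ˣ) : ZMod (3 * n)) * w).val =
        ((u : ZMod (3 * n)) * w + K).val + ((u : ZMod (3 * n)) * w + 2 * K).val := by
      intro w hw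
      have hy := mul_mod_three_ne_zero hu3 (h₁ w hw)
      have hKy : K * ((u : ZMod (3 * n)) * w) = ((((u : ZMod (3 * n)) * w).val % 3 : ℕ) : ZMod (3 * n)) * K := by
        rw [hKdef, K_mul₃]
      have p1 : ((u * w1 : (ZMod (3 * n))ˣ) : ZMod (3 * n)) * w = (u : ZMod (3 * n)) * w + K * ((u : ZMod (3 * n)) * w) := by
        rw [Units.val_mul, hw1]; ring
      have p2 : ((u * w2 : (ZMod (3 * n))ˣ) : ZMod (3 * n)) * w =
          (u : ZMod (3 * n)) * w + 2 * (K * ((u : ZMod (3 * n)) * w)) := by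
        rw [Units.val_mul, hw2]; ring
      rw [p1, p2, hKy]
      have hr : ((u : ZMod (3 * n)) * w).val % 3 < 3 := Nat.mod_lt _ (by norm_num)
      have h3K := three_mul_K (n := n)
      interval_cases hq : ((u : ZMod (3 * n)) * w).val % 3
      · exact absurd rfl hy
      · push_cast
        rw [one_mul]
      · push_cast
        have e4 : (u : ZMod (3 * n)) * w + 2 * (2 * K) = (u : ZMod (3 * n)) * w + K := by
          linear_combination h3K
        rw [e4, add_comm]
    -- the members `≡ 0 (3)`: all three products equal `uw`
    have hKw0 : ∀ w ∈ s₀, K * w = 0 := by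
      intro w hw
      rw [hKdef, K_mul₃, h₀ w hw]
      simp
    have ese2 : (s₀.map fun w ↦ (((u * w1 : (ZMod (3 * n))ˣ) : ZMod (3 * n)) * w).val) =
        s₀.map fun w ↦ ((u : ZMod (3 * n)) * w).val := by
      refine Multiset.map_congr rfl fun w hw ↦ ?_
      rw [Units.val_mul, hw1]
      congr 1
      linear_combination (u : ZMod (3 * n)) * hKw0 w hw
    have ese3 : (s₀.map fun w ↦ (((u * w2 : (ZMod (3 * n))ˣ) : ZMod (3 * n)) * w).val) =
        s₀.map fun w ↦ ((u : ZMod (3 * n)) * w).val := by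
      refine Multiset.map_congr rfl fun w hw ↦ ?_
      rw [Units.val_mul, hw2]
      congr 1
      linear_combination 2 * (u : ZMod (3 * n)) * hKw0 w hw
    rw [ese2] at e2
    rw [ese3] at e3
    have hO : (s₁.map fun w ↦ ((u : ZMod (3 * n)) * w).val).sum +
        ((s₁.map fun w ↦ (((u * w1 : (ZMod (3 * n))ˣ) : ZMod (3 * n)) * w).val).sum +
          (s₁.map fun w ↦ (((u * w2 : (ZMod (3 * n))ˣ) : ZMod (3 * n)) * w).val).sum) =
        3 * (s₁.map fun w ↦ (R ((u : ZMod (3 * n)) * w)).val).sum + 3 * n * Multiset.card s₁ := by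
      rw [← Multiset.sum_map_add, ← Multiset.sum_map_add]
      have : (s₁.map fun w ↦ ((u : ZMod (3 * n)) * w).val +
          ((((u * w1 : (ZMod (3 * n))ˣ) : ZMod (3 * n)) * w).val + (((u * w2 : (ZMod (3 * n))ˣ) : ZMod (3 * n)) * w).val)) =
          s₁.map fun w ↦ 3 * (R ((u : ZMod (3 * n)) * w)).val + 3 * n := by
        refine Multiset.map_congr rfl fun w hw ↦ ?_
        rw [h12 w hw, val_castHom_three, hKdef, ← val_add_three ((u : ZMod (3 * n)) * w)]
        ring
      rw [this, Multiset.sum_map_add, Multiset.sum_map_mul_left, Multiset.map_const', Multiset.sum_replicate, smul_eq_mul,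
        mul_comm (Multiset.card s₁)]
    have hE : (s₀.map fun w ↦ ((u : ZMod (3 * n)) * w).val).sum =
        3 * (s₀.map fun w ↦ (R ((u : ZMod (3 * n)) * ((w.val / 3 : ℕ) : ZMod (3 * n)))).val).sum := by
      rw [← Multiset.sum_map_mul_left]
      congr 1
      refine Multiset.map_congr rfl fun w hw ↦ ?_
      rw [val_castHom_three, ← val_three_mul_eq, mul_left_comm, three_mul_third (h₀ w hw)]
    simp only [Multiset.map_add, mNormSum_add, Multiset.map_map, mNormSum_map', Multiset.card_add, Multiset.card_map,
      Function.comp_apply]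
    have tso : (s₁.map fun w ↦ ((v : ZMod n) * R w).val) = s₁.map fun w ↦ (R ((u : ZMod (3 * n)) * w)).val := by
      refine Multiset.map_congr rfl fun w _ ↦ ?_
      rw [hvu, ← map_mul]
    have tse : (s₀.map fun w ↦ ((v : ZMod n) * R ((w.val / 3 : ℕ) : ZMod (3 * n))).val) =
        s₀.map fun w ↦ (R ((u : ZMod (3 * n)) * ((w.val / 3 : ℕ) : ZMod (3 * n)))).val := by
      refine Multiset.map_congr rfl fun w _ ↦ ?_
      rw [hvu, ← map_mul]
    rw [tso, tse]
    generalize Multiset.card s₁ = c₁ at e1 e2 e3 hO ⊢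
    generalize Multiset.card s₀ = c₀ at e1 e2 e3 ⊢
    generalize (s₁.map fun w ↦ (R ((u : ZMod (3 * n)) * w)).val).sum = A at hO ⊢
    generalize (s₀.map fun w ↦ (R ((u : ZMod (3 * n)) * ((w.val / 3 : ℕ) : ZMod (3 * n)))).val).sum = B at hE ⊢
    generalize (s₁.map fun w ↦ ((u : ZMod (3 * n)) * w).val).sum = A₁ at e1 hO
    generalize (s₁.map fun w ↦ (((u * w1 : (ZMod (3 * n))ˣ) : ZMod (3 * n)) * w).val).sum = A₂ at e2 hO
    generalize (s₁.map fun w ↦ (((u * w2 : (ZMod (3 * n))ˣ) : ZMod (3 * n)) * w).val).sum = A₃ at e3 hO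
    generalize (s₀.map fun w ↦ ((u : ZMod (3 * n)) * w).val).sum = B₁ at e1 e2 e3 hE
    have e4 : 3 * n * (c₁ + c₀) = 3 * (n * c₁) + 3 * (n * c₀) := by ring
    rw [e4] at e1 e2 e3
    have e5 : 3 * n * c₁ = 3 * (n * c₁) := by ring
    rw [e5] at hO
    have : n * (c₁ + (c₀ + c₀ + c₀)) = n * c₁ + 3 * (n * c₀) := by ring
    rw [this]
    omega


/-! ### Arithmetic of representatives at the levels `ℓn` and `n` (`ℓ` prime, `ℓ ∣ n`) -/

section PrimeTransfer

variable {ℓ : ℕ}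

/-- `ℓ·n = 0` at level `ℓn`. [folklore] -/
private theorem ell_mul_K : (ℓ : ZMod (ℓ * n)) * (n : ZMod (ℓ * n)) = 0 := by
  rw [← Nat.cast_mul, ZMod.natCast_self]

/-- `n·n = 0` at level `ℓn` when `ℓ ∣ n`. [folklore] -/
private theorem K_mul_Kₗ (hn : ℓ ∣ n) : (n : ZMod (ℓ * n)) * (n : ZMod (ℓ * n)) = 0 := by
  obtain ⟨k, rfl⟩ := hn
  have : ((ℓ * k : ℕ) : ZMod (ℓ * (ℓ * k))) * ((ℓ * k : ℕ) : ZMod (ℓ * (ℓ * k))) =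
      (k : ZMod (ℓ * (ℓ * k))) * ((ℓ * (ℓ * k) : ℕ) : ZMod (ℓ * (ℓ * k))) := by push_cast; ring
  rw [this, ZMod.natCast_self, mul_zero]

/-- `n · x = (⟨x⟩ mod ℓ) · n` at level `ℓn`. [folklore] -/
private theorem K_mulₗ [NeZero n] (hℓ : 0 < ℓ) (x : ZMod (ℓ * n)) :
    (n : ZMod (ℓ * n)) * x = ((x.val % ℓ : ℕ) : ZMod (ℓ * n)) * (n : ZMod (ℓ * n)) := by
  haveI : NeZero (ℓ * n) := ⟨Nat.pos_iff_ne_zero.mp (Nat.mul_pos hℓ (NeZero.pos n))⟩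
  have e : x = ((x.val : ℕ) : ZMod (ℓ * n)) := (ZMod.natCast_zmod_val x).symm
  have hd := Nat.div_add_mod x.val ℓ
  have h3 := ell_mul_K (ℓ := ℓ) (n := n)
  conv_lhs => rw [e, ← hd]
  push_cast
  linear_combination (↑(x.val / ℓ) : ZMod (ℓ * n)) * h3

/-- `(j mod ℓ) · n = j · n` at level `ℓn`. [folklore] -/
private theorem natCast_mod_mul_K (j : ℕ) :
    (((j % ℓ : ℕ)) : ZMod (ℓ * n)) * (n : ZMod (ℓ * n)) = (j : ZMod (ℓ * n)) * (n : ZMod (ℓ * n)) := by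
  have hd := Nat.div_add_mod j ℓ
  have h3 := ell_mul_K (ℓ := ℓ) (n := n)
  conv_rhs => rw [← hd]
  push_cast
  linear_combination -(↑(j / ℓ) : ZMod (ℓ * n)) * h3

/-- A unit of `ℤ/ℓn` is not divisible by `ℓ` (`ℓ ≥ 2`). [folklore] -/
private theorem mod_ne_zero_of_isUnitₗ [NeZero n] (hℓ : 2 ≤ ℓ) {u : ZMod (ℓ * n)} (hu : IsUnit u) : u.val % ℓ ≠ 0 := by
  haveI : NeZero (ℓ * n) := ⟨Nat.pos_iff_ne_zero.mp (Nat.mul_pos (by omega) (NeZero.pos n))⟩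
  obtain ⟨u, rfl⟩ := hu
  have hc := ZMod.val_coe_unit_coprime u
  intro h
  have h3 : ℓ ∣ (u : ZMod (ℓ * n)).val := Nat.dvd_of_mod_eq_zero h
  have : ℓ ∣ Nat.gcd (u : ZMod (ℓ * n)).val (ℓ * n) := Nat.dvd_gcd h3 ⟨n, rfl⟩
  rw [hc] at this
  have := Nat.le_of_dvd one_pos this
  omega

/-- `1 + j·n` is a unit of `ℤ/ℓn` (with inverse `1 − j·n`) when `ℓ ∣ n`. [folklore] -/
private theorem isUnit_one_add_mul_Kₗ (hn : ℓ ∣ n) (j : ℕ) : IsUnit (1 + (j : ZMod (ℓ * n)) * (n : ZMod (ℓ * n))) := by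
  have h1 : (1 + (j : ZMod (ℓ * n)) * (n : ZMod (ℓ * n))) * (1 - (j : ZMod (ℓ * n)) * (n : ZMod (ℓ * n))) = 1 := by
    linear_combination (-(j : ZMod (ℓ * n)) * (j : ZMod (ℓ * n))) * K_mul_Kₗ hn
  have h2 : (1 - (j : ZMod (ℓ * n)) * (n : ZMod (ℓ * n))) * (1 + (j : ZMod (ℓ * n)) * (n : ZMod (ℓ * n))) = 1 := by
    linear_combination h1
  exact ⟨⟨_, _, h1, h2⟩, rfl⟩

/-- The product of two residues not divisible by the prime `ℓ` is not divisible by `ℓ` (level `ℓn`). [folklore] -/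
private theorem mul_mod_ne_zeroₗ [NeZero n] (hℓ : ℓ.Prime) {u w : ZMod (ℓ * n)} (hu : u.val % ℓ ≠ 0) (hw : w.val % ℓ ≠ 0) :
    (u * w).val % ℓ ≠ 0 := by
  haveI : NeZero (ℓ * n) := ⟨Nat.pos_iff_ne_zero.mp (Nat.mul_pos hℓ.pos (NeZero.pos n))⟩
  rw [ZMod.val_mul, Nat.mod_mod_of_dvd _ ⟨n, rfl⟩]
  intro h
  rcases (Nat.Prime.dvd_mul hℓ).1 (Nat.dvd_of_mod_eq_zero h) with h' | h'
  · exact hu (Nat.mod_eq_zero_of_dvd h')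
  · exact hw (Nat.mod_eq_zero_of_dvd h')

/-- **`⟨y + j·n⟩ = (⟨y⟩ mod n) + ((⟨y⟩ div n + j) mod ℓ)·n`** at level `ℓn`. [folklore] -/
private theorem val_add_mul_Kₗ [NeZero n] (hℓ : 0 < ℓ) (y : ZMod (ℓ * n)) (j : ℕ) :
    (y + (j : ZMod (ℓ * n)) * (n : ZMod (ℓ * n))).val = y.val % n + ((y.val / n + j) % ℓ) * n := by
  haveI : NeZero (ℓ * n) := ⟨Nat.pos_iff_ne_zero.mp (Nat.mul_pos hℓ (NeZero.pos n))⟩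
  have hn := NeZero.pos n
  have e : y + (j : ZMod (ℓ * n)) * (n : ZMod (ℓ * n)) = ((y.val + j * n : ℕ) : ZMod (ℓ * n)) := by
    push_cast; rw [ZMod.natCast_zmod_val]
  rw [e, ZMod.val_natCast]
  have hdm : n * (y.val / n) + y.val % n = y.val := Nat.div_add_mod y.val n
  have htn : y.val % n < n := Nat.mod_lt _ hn
  have hbl : (y.val / n + j) % ℓ < ℓ := Nat.mod_lt _ hℓ
  have hdb : ℓ * ((y.val / n + j) / ℓ) + (y.val / n + j) % ℓ = y.val / n + j := Nat.div_add_mod _ ℓ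
  have e2 : y.val + j * n = (y.val % n + ((y.val / n + j) % ℓ) * n) + (ℓ * n) * ((y.val / n + j) / ℓ) := by
    have : y.val + j * n = y.val % n + (y.val / n + j) * n := by
      conv_lhs => rw [← hdm]
      ring
    rw [this]
    conv_lhs => rw [← hdb]
    ring
  have hlt : y.val % n + ((y.val / n + j) % ℓ) * n < ℓ * n := by
    have h1 : ((y.val / n + j) % ℓ + 1) * n ≤ ℓ * n := Nat.mul_le_mul_right n hbl
    rw [Nat.add_mul, one_mul] at h1
    omega
  rw [e2, Nat.add_mul_mod_self_left, Nat.mod_eq_of_lt hlt]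

/-- **`⟨ℓ y⟩ = ℓ(⟨y⟩ mod n)`** at level `ℓn`. [folklore] -/
private theorem val_ell_mul_eq [NeZero n] (hℓ : 0 < ℓ) (y : ZMod (ℓ * n)) : ((ℓ : ZMod (ℓ * n)) * y).val = ℓ * (y.val % n) := by
  haveI : NeZero (ℓ * n) := ⟨Nat.pos_iff_ne_zero.mp (Nat.mul_pos hℓ (NeZero.pos n))⟩
  have hn := NeZero.pos n
  have e : (ℓ : ZMod (ℓ * n)) * y = ((ℓ * y.val : ℕ) : ZMod (ℓ * n)) := by
    push_cast; rw [ZMod.natCast_zmod_val]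
  rw [e, ZMod.val_natCast]
  have hdm := Nat.div_add_mod y.val n
  have hml := Nat.mod_lt y.val hn
  have e2 : ℓ * y.val = ℓ * (y.val % n) + (ℓ * n) * (y.val / n) := by
    conv_lhs => rw [← hdm]
    ring
  have hlt : ℓ * (y.val % n) < ℓ * n := Nat.mul_lt_mul_of_pos_left hml hℓ
  rw [e2, Nat.add_mul_mod_self_left, Nat.mod_eq_of_lt hlt]

/-- The reduction `ℤ/ℓn → ℤ/n` on representatives. [folklore] -/
private theorem val_castHomₗ [NeZero n] (hℓ : 0 < ℓ) (hnm : n ∣ ℓ * n) (y : ZMod (ℓ * n)) :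
    (ZMod.castHom hnm (ZMod n) y).val = y.val % n := by
  haveI : NeZero (ℓ * n) := ⟨Nat.pos_iff_ne_zero.mp (Nat.mul_pos hℓ (NeZero.pos n))⟩
  rw [ZMod.castHom_apply, ZMod.cast_eq_val, ZMod.val_natCast]

/-- `ℓ · (⟨w⟩/ℓ) = w` for `w` with representative `≡ 0 (mod ℓ)` (level `ℓn`). [folklore] -/
private theorem ell_mul_div [NeZero n] (hℓ : 0 < ℓ) {w : ZMod (ℓ * n)} (hw : w.val % ℓ = 0) :
    (ℓ : ZMod (ℓ * n)) * ((w.val / ℓ : ℕ) : ZMod (ℓ * n)) = w := by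
  haveI : NeZero (ℓ * n) := ⟨Nat.pos_iff_ne_zero.mp (Nat.mul_pos hℓ (NeZero.pos n))⟩
  have h := Nat.div_add_mod w.val ℓ
  rw [hw, add_zero] at h
  calc (ℓ : ZMod (ℓ * n)) * ((w.val / ℓ : ℕ) : ZMod (ℓ * n)) = (((ℓ * (w.val / ℓ) : ℕ)) : ZMod (ℓ * n)) := by push_cast; ring
    _ = w := by rw [h, ZMod.natCast_zmod_val]

/-- Sums over `ℤ/ℓ` by representatives are sums over `range ℓ`. [folklore] -/
private theorem sum_zmod_val_eq_sum_range [NeZero ℓ] (F : ℕ → ℕ) : ∑ x : ZMod ℓ, F x.val = ∑ j ∈ Finset.range ℓ, F j := by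
  obtain ⟨k, hk⟩ : ∃ k, ℓ = k + 1 := ⟨ℓ - 1, (Nat.succ_pred_eq_of_pos (NeZero.pos ℓ)).symm⟩
  subst hk
  exact Fin.sum_univ_eq_sum_range F (k + 1)

/-- `2 Σ_{x ∈ ℤ/ℓ} ⟨x⟩ = ℓ(ℓ − 1)`. [folklore] -/
private theorem two_mul_sum_zmod_val [NeZero ℓ] : 2 * ∑ x : ZMod ℓ, x.val = ℓ * (ℓ - 1) := by
  have h := sum_zmod_val_eq_sum_range (ℓ := ℓ) (fun j ↦ j)
  rw [h, mul_comm, Finset.sum_range_id_mul_two]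

/-- Translation invariance: `Σ_x F(⟨q + x⟩) = Σ_x F(⟨x⟩)` over `ℤ/ℓ`. [folklore] -/
private theorem sum_zmod_val_add [NeZero ℓ] (F : ℕ → ℕ) (q : ZMod ℓ) :
    ∑ x : ZMod ℓ, F (q + x).val = ∑ x : ZMod ℓ, F x.val :=
  Equiv.sum_comp (Equiv.addLeft q) (fun x ↦ F x.val)

/-- Dilation invariance: `Σ_x F(⟨x r⟩) = Σ_x F(⟨x⟩)` over the field `ℤ/ℓ`, `r ≠ 0`. [folklore] -/
private theorem sum_zmod_val_mul [Fact ℓ.Prime] (F : ℕ → ℕ) {r : ZMod ℓ} (hr : r ≠ 0) :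
    ∑ x : ZMod ℓ, F (x * r).val = ∑ x : ZMod ℓ, F x.val :=
  Equiv.sum_comp (Equiv.mulRight₀ r hr) (fun x ↦ F x.val)

/-- **`Σ_{j mod ℓ} ⟨y + j n⟩ = ℓ(⟨y⟩ mod n) + n Σ_{j mod ℓ} j`** at level `ℓn`. [folklore] -/
private theorem sum_val_add_mul_K [NeZero n] [NeZero ℓ] (y : ZMod (ℓ * n)) :
    ∑ x : ZMod ℓ, (y + (x.val : ZMod (ℓ * n)) * (n : ZMod (ℓ * n))).val = ℓ * (y.val % n) + n * ∑ x : ZMod ℓ, x.val := by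
  have hℓ := NeZero.pos ℓ
  have e : ∀ x : ZMod ℓ, (y + (x.val : ZMod (ℓ * n)) * (n : ZMod (ℓ * n))).val =
      y.val % n + (((y.val / n : ℕ) : ZMod ℓ) + x).val * n := by
    intro x
    rw [val_add_mul_Kₗ hℓ, ZMod.val_add, ZMod.val_natCast, Nat.mod_add_mod]
  have h := sum_zmod_val_add (ℓ := ℓ) (fun j ↦ j) (((y.val / n : ℕ) : ZMod ℓ))
  simp only [e, Finset.sum_add_distrib, Finset.sum_const, Finset.card_univ, ZMod.card, smul_eq_mul, ← Finset.sum_mul, h]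
  ring

/-- **Transfer `ℓn → n` for a prime `ℓ ∣ n`.** Split a multiset over `ℤ/ℓn` into its members with representative `≢ 0 (mod ℓ)`
(`s₁`) and `≡ 0 (mod ℓ)` (`s₀`); if `s₁ + s₀` is a Hodge multiset of level `ℓn`, then
`T_ℓ = (s₁ reduced mod n) + ℓ·((representatives of s₀)/ℓ, read mod n)` is a Hodge multiset of level `n`. PROOF: for a unit `u` of
`ℤ/ℓn` the `ℓ` products `u(1 + jn)`, `j mod ℓ`, are units (`n² ≡ 0`); for `ℓ ∤ ⟨w⟩` the products `u(1 + jn)w = uw + j⟨uw⟩n` run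
through `uw + kn`, `k mod ℓ` (`ℓ` prime), and `Σ_k ⟨y + kn⟩ = ℓ(⟨y⟩ mod n) + n·ℓ(ℓ−1)/2`; for `ℓ ∣ ⟨w⟩` all products equal
`uw = ℓ·u(w/ℓ)` and `⟨ℓy⟩ = ℓ(⟨y⟩ mod n)`; add the `ℓ` norm equations and divide by `ℓ`. (The cases `ℓ = 2, 3` are
`isHodgeMultiset_transfer_two/three` above, kept for their users.) [cite: Aoki1983, Prop. 2.2] [cite: Shioda1979PJA, §1 eq. (2)] -/
theorem isHodgeMultiset_transfer_prime [NeZero n] (hℓ : ℓ.Prime) (hn : ℓ ∣ n) (hnm : n ∣ ℓ * n) {s₁ s₀ : Multiset (ZMod (ℓ * n))}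
    (h₁ : ∀ w ∈ s₁, w.val % ℓ ≠ 0) (h₀ : ∀ w ∈ s₀, w.val % ℓ = 0) (hs : IsHodgeMultiset (s₁ + s₀)) :
    IsHodgeMultiset (s₁.map (ZMod.castHom hnm (ZMod n)) +
      ℓ • s₀.map fun w ↦ ZMod.castHom hnm (ZMod n) ((w.val / ℓ : ℕ) : ZMod (ℓ * n))) := by
  classical
  haveI := Fact.mk hℓ
  haveI : NeZero ℓ := ⟨hℓ.ne_zero⟩
  have hℓ0 := hℓ.pos
  haveI : NeZero (ℓ * n) := ⟨Nat.pos_iff_ne_zero.mp (Nat.mul_pos hℓ0 (NeZero.pos n))⟩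
  have hn0 := NeZero.pos n
  set R := ZMod.castHom hnm (ZMod n) with hR
  obtain ⟨⟨hne, hsum⟩, hnorm⟩ := hs
  refine ⟨⟨?_, ?_⟩, fun v ↦ ?_⟩
  · -- members are non-zero
    intro a ha
    rcases Multiset.mem_add.mp ha with ha | ha
    · obtain ⟨w, hw, rfl⟩ := Multiset.mem_map.mp ha
      intro h
      have hv := congrArg ZMod.val h
      rw [val_castHomₗ hℓ0, ZMod.val_zero] at hv
      obtain ⟨k, hk⟩ := Nat.dvd_of_mod_eq_zero hv
      obtain ⟨j, hj⟩ := hn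
      exact h₁ w hw (Nat.mod_eq_zero_of_dvd ⟨j * k, by rw [hk, hj, mul_assoc]⟩)
    · obtain ⟨-, ha⟩ := Multiset.mem_nsmul.mp ha
      obtain ⟨w, hw, rfl⟩ := Multiset.mem_map.mp ha
      intro h
      have hv := congrArg ZMod.val h
      rw [val_castHomₗ hℓ0, ZMod.val_zero, ZMod.val_natCast, Nat.mod_mod_of_dvd _ hnm] at hv
      have hlt := ZMod.val_lt w
      obtain ⟨c, hc⟩ := Nat.dvd_of_mod_eq_zero hv
      have hd := Nat.div_add_mod w.val ℓ
      rw [h₀ w hw, add_zero, hc] at hd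
      have hc0 : c = 0 := by
        by_contra hc0
        have : ℓ * n ≤ ℓ * (n * c) := Nat.mul_le_mul_left ℓ (Nat.le_mul_of_pos_right n (Nat.pos_of_ne_zero hc0))
        omega
      rw [hc0, mul_zero, mul_zero] at hd
      exact hne w (Multiset.mem_add.mpr (Or.inr hw)) ((ZMod.val_eq_zero w).mp hd.symm)
  · -- the sum is zero
    have e1 : (s₁.map R).sum = R s₁.sum := (map_multiset_sum R s₁).symm
    have e2 : (ℓ • s₀.map fun w ↦ R ((w.val / ℓ : ℕ) : ZMod (ℓ * n))).sum = R s₀.sum := by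
      rw [Multiset.sum_nsmul, ← Multiset.sum_map_nsmul, map_multiset_sum]
      congr 1
      refine Multiset.map_congr rfl fun w hw ↦ ?_
      rw [nsmul_eq_mul, ← map_natCast R ℓ, ← RingHom.map_mul, ell_mul_div hℓ0 (h₀ w hw)]
    rw [Multiset.sum_add, e1, e2, ← RingHom.map_add, ← Multiset.sum_add, hsum, RingHom.map_zero]
  · -- the norm equations
    obtain ⟨u, hu⟩ := ZMod.unitsMap_surjective hnm v
    have hvu : (v : ZMod n) = R u := by rw [← hu]; simp [ZMod.unitsMap_def, hR]
    have huℓ : (u : ZMod (ℓ * n)).val % ℓ ≠ 0 := mod_ne_zero_of_isUnitₗ hℓ.two_le u.isUnit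
    -- the units `u (1 + j n)`, `j mod ℓ`
    set U : ZMod ℓ → (ZMod (ℓ * n))ˣ := fun x ↦ u * (isUnit_one_add_mul_Kₗ hn x.val).unit with hU
    have hUval : ∀ x : ZMod ℓ, ((U x : (ZMod (ℓ * n))ˣ) : ZMod (ℓ * n)) =
        (u : ZMod (ℓ * n)) * (1 + (x.val : ZMod (ℓ * n)) * (n : ZMod (ℓ * n))) := by
      intro x; rw [hU]; simp only [Units.val_mul, IsUnit.unit_spec]
    have e : ∀ x : ZMod ℓ, 2 * (mNormSum (s₁.map fun a ↦ ((U x : (ZMod (ℓ * n))ˣ) : ZMod (ℓ * n)) * a) +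
        mNormSum (s₀.map fun a ↦ ((U x : (ZMod (ℓ * n))ˣ) : ZMod (ℓ * n)) * a)) =
        ℓ * n * (Multiset.card s₁ + Multiset.card s₀) := by
      intro x
      have := hnorm (U x)
      rwa [Multiset.map_add, mNormSum_add, Multiset.card_add] at this
    -- members `≡ 0 (ℓ)`: all products equal `uw`
    have hE0 : ∀ x : ZMod ℓ, mNormSum (s₀.map fun a ↦ ((U x : (ZMod (ℓ * n))ˣ) : ZMod (ℓ * n)) * a) =
        ℓ * (s₀.map fun w ↦ (R ((u : ZMod (ℓ * n)) * ((w.val / ℓ : ℕ) : ZMod (ℓ * n)))).val).sum := by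
      intro x
      rw [mNormSum, Multiset.map_map, ← Multiset.sum_map_mul_left]
      congr 1
      refine Multiset.map_congr rfl fun w hw ↦ ?_
      have hKw : (n : ZMod (ℓ * n)) * w = 0 := by rw [K_mulₗ hℓ0 w, h₀ w hw, Nat.cast_zero, zero_mul]
      have hw' := ell_mul_div hℓ0 (h₀ w hw)
      rw [Function.comp_apply, val_castHomₗ hℓ0, ← val_ell_mul_eq hℓ0, hUval]
      congr 1
      linear_combination (u : ZMod (ℓ * n)) * (x.val : ZMod (ℓ * n)) * hKw - (u : ZMod (ℓ * n)) * hw'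
    -- members `≢ 0 (ℓ)`: the products run through `uw + k n`, `k mod ℓ`
    have each : ∀ w ∈ s₁, ∑ x : ZMod ℓ, (((U x : (ZMod (ℓ * n))ˣ) : ZMod (ℓ * n)) * w).val =
        ℓ * ((R ((u : ZMod (ℓ * n)) * w)).val) + n * ∑ x : ZMod ℓ, x.val := by
      intro w hw
      have hyℓ : ((u : ZMod (ℓ * n)) * w).val % ℓ ≠ 0 := mul_mod_ne_zeroₗ hℓ huℓ (h₁ w hw)
      have hr : ((((u : ZMod (ℓ * n)) * w).val : ℕ) : ZMod ℓ) ≠ 0 := by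
        rw [Ne, ZMod.natCast_eq_zero_iff]
        exact fun h ↦ hyℓ (Nat.mod_eq_zero_of_dvd h)
      have prod : ∀ x : ZMod ℓ, ((U x : (ZMod (ℓ * n))ˣ) : ZMod (ℓ * n)) * w =
          (u : ZMod (ℓ * n)) * w +
            (((x * ((((u : ZMod (ℓ * n)) * w).val : ℕ) : ZMod ℓ)).val : ℕ) : ZMod (ℓ * n)) * (n : ZMod (ℓ * n)) := by
        intro x
        rw [hUval, ZMod.val_mul, ZMod.val_natCast, natCast_mod_mul_K, Nat.cast_mul]
        linear_combination (x.val : ZMod (ℓ * n)) * K_mulₗ hℓ0 ((u : ZMod (ℓ * n)) * w)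
      rw [val_castHomₗ hℓ0]
      calc ∑ x : ZMod ℓ, (((U x : (ZMod (ℓ * n))ˣ) : ZMod (ℓ * n)) * w).val
          = ∑ x : ZMod ℓ, ((u : ZMod (ℓ * n)) * w +
              (((x * ((((u : ZMod (ℓ * n)) * w).val : ℕ) : ZMod ℓ)).val : ℕ) : ZMod (ℓ * n)) * (n : ZMod (ℓ * n))).val := by
            simp only [prod]
        _ = ∑ x : ZMod ℓ, ((u : ZMod (ℓ * n)) * w + ((x.val : ℕ) : ZMod (ℓ * n)) * (n : ZMod (ℓ * n))).val :=
            sum_zmod_val_mul (fun k ↦ ((u : ZMod (ℓ * n)) * w + ((k : ℕ) : ZMod (ℓ * n)) * (n : ZMod (ℓ * n))).val) hr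
        _ = ℓ * (((u : ZMod (ℓ * n)) * w).val % n) + n * ∑ x : ZMod ℓ, x.val := sum_val_add_mul_K _
    have hE1 : ∑ x : ZMod ℓ, mNormSum (s₁.map fun a ↦ ((U x : (ZMod (ℓ * n))ˣ) : ZMod (ℓ * n)) * a) =
        ℓ * (s₁.map fun w ↦ (R ((u : ZMod (ℓ * n)) * w)).val).sum +
          (n * ∑ x : ZMod ℓ, x.val) * Multiset.card s₁ := by
      have swap : ∑ x : ZMod ℓ, mNormSum (s₁.map fun a ↦ ((U x : (ZMod (ℓ * n))ˣ) : ZMod (ℓ * n)) * a) =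
          (s₁.map fun w ↦ ∑ x : ZMod ℓ, (((U x : (ZMod (ℓ * n))ˣ) : ZMod (ℓ * n)) * w).val).sum := by
        simp only [mNormSum, Multiset.map_map, Function.comp_def]
        rw [Finset.sum_eq_multiset_sum, Multiset.sum_map_sum_map]
        rfl
      rw [swap]
      have : (s₁.map fun w ↦ ∑ x : ZMod ℓ, (((U x : (ZMod (ℓ * n))ˣ) : ZMod (ℓ * n)) * w).val) =
          s₁.map fun w ↦ ℓ * (R ((u : ZMod (ℓ * n)) * w)).val + n * ∑ x : ZMod ℓ, x.val :=
        Multiset.map_congr rfl each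
      rw [this, Multiset.sum_map_add, Multiset.sum_map_mul_left, Multiset.map_const', Multiset.sum_replicate, smul_eq_mul,
        mul_comm (Multiset.card s₁)]
    -- add the `ℓ` norm equations
    have tot : ∑ x : ZMod ℓ, 2 * (mNormSum (s₁.map fun a ↦ ((U x : (ZMod (ℓ * n))ˣ) : ZMod (ℓ * n)) * a) +
        mNormSum (s₀.map fun a ↦ ((U x : (ZMod (ℓ * n))ˣ) : ZMod (ℓ * n)) * a)) =
        ∑ x : ZMod ℓ, ℓ * n * (Multiset.card s₁ + Multiset.card s₀) := Finset.sum_congr rfl fun x _ ↦ e x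
    rw [← Finset.mul_sum, Finset.sum_add_distrib, hE1] at tot
    simp only [hE0, Finset.sum_const, Finset.card_univ, ZMod.card, smul_eq_mul] at tot
    have hS := two_mul_sum_zmod_val (ℓ := ℓ)
    -- the norm equation of the transferred multiset
    simp only [mNormSum, Multiset.map_add, Multiset.map_nsmul, Multiset.map_map, Function.comp_def, Multiset.sum_add,
      Multiset.sum_nsmul, smul_eq_mul, Multiset.card_add, Multiset.card_nsmul, Multiset.card_map]
    have tso : (s₁.map fun w ↦ ((v : ZMod n) * R w).val) = s₁.map fun w ↦ (R ((u : ZMod (ℓ * n)) * w)).val := by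
      refine Multiset.map_congr rfl fun w _ ↦ ?_
      rw [hvu, ← map_mul]
    have tse : (s₀.map fun w ↦ ((v : ZMod n) * R ((w.val / ℓ : ℕ) : ZMod (ℓ * n))).val) =
        s₀.map fun w ↦ (R ((u : ZMod (ℓ * n)) * ((w.val / ℓ : ℕ) : ZMod (ℓ * n)))).val := by
      refine Multiset.map_congr rfl fun w _ ↦ ?_
      rw [hvu, ← map_mul]
    rw [tso, tse]
    generalize (s₁.map fun w ↦ (R ((u : ZMod (ℓ * n)) * w)).val).sum = A at tot ⊢
    generalize (s₀.map fun w ↦ (R ((u : ZMod (ℓ * n)) * ((w.val / ℓ : ℕ) : ZMod (ℓ * n)))).val).sum = B at tot ⊢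
    generalize (∑ x : ZMod ℓ, x.val) = S at tot hS
    generalize Multiset.card s₁ = c₁ at tot ⊢
    generalize Multiset.card s₀ = c₀ at tot ⊢
    have hℓ1 : 1 ≤ ℓ := hℓ0
    zify [hℓ1] at tot hS ⊢
    have key : (ℓ : ℤ) * (2 * (A + ℓ * B) - n * (c₁ + ℓ * c₀)) = 0 := by
      linear_combination tot - (n : ℤ) * (c₁ : ℤ) * hS
    rcases mul_eq_zero.mp key with h | h
    · exfalso; exact hℓ.ne_zero (by exact_mod_cast h)
    · linarith

end PrimeTransfer

end FermatCharacter

end Literature.AlgebraicGeometry.HodgeTheory
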